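import Literature.AlgebraicGeometry.Resolution.StrictTransformIsBlowup
import Literature.AlgebraicGeometry.Resolution.BlowupsFlatBaseChange
import HarnessLib

/-!
# The strict transform of a flat scheme is its base change (Stacks 080F)

Topic: `Literature/AlgebraicGeometry/Resolution`. The Stacks Project, Tag 080F (Divisors,
Lemma 31.34.3 (1)): "If `X` is flat over `S` at all points lying over `Z`, then the strict
transform of `X` is equal to the base change `X ×_S S'`." Proved here for `f : X → S` flat
(everywhere), for the scheme-theoretic strict transform `blowupStrictTransform f b 𝓘` of the
named fact `Stacks081R` along a morphism `b` for which `b⁻¹𝓘 𝒪_{S'}` is an effective Cartier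
divisor (a blowing up in `𝓘`): the base change `X ×_S S' → S'` of the flat `f` is flat, so the
pulled-back exceptional divisor is still an effective Cartier divisor on `X ×_S S'`
(`IsEffectiveCartier.comap_of_flat`); on a chart its local equation `t` is a nonzerodivisor,
and the ideal of the strict transform — the `t`-power torsion
(`mem_ideal_blowupStrictTransform_iff`) — vanishes.

* `ker_blowupStrictTransformι_eq_bot_of_flat` — the ideal of `X' ⊆ X ×_S S'` is zero;
* `isIso_blowupStrictTransformι_of_flat` — **`X' = X ×_S S'` for `f` flat.**

## References

* The Stacks Project, Tag 080F (Divisors, Lemma 31.34.3 (1)). [StacksProject]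
-/

noncomputable section

open CategoryTheory CategoryTheory.Limits AlgebraicGeometry TopologicalSpace

namespace Literature.AlgebraicGeometry.Resolution

universe u

variable {X S S' : Scheme.{u}} (f : X ⟶ S) (b : S' ⟶ S) (I : S.IdealSheafData)

/-- Mutual divisibility with a nonzerodivisor (local copy, cf. `StrictTransformIsBlowup.lean`).
[folklore] -/
private theorem mem_nonZeroDivisors_of_span_eq_span' {A : Type*} [CommRing A] {x y : A}
    (h : Ideal.span {x} = Ideal.span {y}) (hy : y ∈ nonZeroDivisors A) : x ∈ nonZeroDivisors A := by
  obtain ⟨a, rfl⟩ : ∃ a, a * y = x := Ideal.mem_span_singleton'.mp (h ▸ Ideal.mem_span_singleton_self x)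
  obtain ⟨c, hc⟩ : ∃ c, c * (a * y) = y :=
    Ideal.mem_span_singleton'.mp (h.symm ▸ Ideal.mem_span_singleton_self y)
  have hca : c * a = 1 := by
    have h1 : (c * a - 1) * y = 0 := by rw [sub_mul, one_mul, mul_assoc, hc, sub_self]
    exact sub_eq_zero.mp ((mem_nonZeroDivisors_iff_right.mp hy) _ h1)
  exact mul_mem (IsUnit.mem_nonZeroDivisors (isUnit_iff_exists_inv.mpr ⟨c, by rwa [mul_comm] at hca⟩)) hy

/-- **For `f` flat the strict transform has zero ideal in `X ×_S S'`** (`b⁻¹𝓘 𝒪_{S'}` an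
effective Cartier divisor): the pulled-back divisor on the flat `S'`-scheme `X ×_S S'` is an
effective Cartier divisor, so its local equations are nonzerodivisors and the torsion ideal of
the strict transform vanishes. [cite: StacksProject, Tag 080F] -/
theorem ker_blowupStrictTransformι_eq_bot_of_flat [Flat f] (hE : IsEffectiveCartier (I.comap b)) :
    (blowupStrictTransformι f b I).ker = ⊥ := by
  -- the pulled-back divisor is effective Cartier on the flat `S'`-scheme `X ×_S S'`
  have hJ : IsEffectiveCartier ((I.comap b).comap (pullback.snd f b)) := hE.comap_of_flat _
  refine eq_bot_of_forall_exists_ideal_eq_bot fun p => ?_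
  obtain ⟨W, t, hpW, -, hW, hJW⟩ := exists_chart f b I hE p ⊤ trivial
  -- a smaller chart on which the local equation is a nonzerodivisor
  obtain ⟨A, hpA, hAW, r, hr, hrA⟩ := hJ.exists_chart_le p W hpW
  have htA : ((I.comap b).comap (pullback.snd f b)).ideal A =
      Ideal.span {(pullback f b).presheaf.map (homOfLE hAW).op t} := by
    rw [← ((I.comap b).comap (pullback.snd f b)).map_ideal (U := A) (V := W) hAW, hJW,
      Ideal.map_span, Set.image_singleton]
    rfl
  have ht : (pullback f b).presheaf.map (homOfLE hAW).op t ∈ nonZeroDivisors _ :=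
    mem_nonZeroDivisors_of_span_eq_span' (htA.symm.trans hrA) hr
  -- `(A, t|_A)` is again a chart: `A ∖ E = D(t|_A)`
  have hA : (pullback.snd f b ⁻¹ᵁ (b ⁻¹ᵁ centreCompl I)) ⊓ (A : (pullback f b).Opens) =
      (pullback f b).basicOpen ((pullback f b).presheaf.map (homOfLE hAW).op t) := by
    rw [Scheme.basicOpen_res, ← hW, ← inf_assoc, inf_comm (A : (pullback f b).Opens), inf_assoc,
      inf_eq_left.mpr hAW]
  refine ⟨A, hpA, ?_⟩
  rw [eq_bot_iff]
  intro x hx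
  obtain ⟨n, hn⟩ := (mem_ideal_blowupStrictTransform_iff f b I hE A _ hA x).mp hx
  exact (Submodule.mem_bot _).mpr ((mem_nonZeroDivisors_iff_right.mp (pow_mem ht n)) _
    (by rwa [mul_comm] at hn))

/-- **Stacks, Tag 080F (1): for `f : X → S` flat, the strict transform of `X` along a blowing
up `b : S' → S` is the whole base change `X ×_S S'`** (the closed immersion
`X' → X ×_S S'` is an isomorphism). [cite: StacksProject, Tag 080F] -/
theorem isIso_blowupStrictTransformι_of_flat [Flat f] (hE : IsEffectiveCartier (I.comap b)) :
    IsIso (blowupStrictTransformι f b I) :=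
  IsClosedImmersion.isIso_iff_ker_eq_bot.mpr (ker_blowupStrictTransformι_eq_bot_of_flat f b I hE)

end Literature.AlgebraicGeometry.Resolution

end
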